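import Summits.ResolutionOfSingularities.ResolutionOfSingularities.Theorems.EquisingularLiftEquisingularLiftNatCarrierDichotomy
import HarnessLib

/-!
# [OURS · L1 W4.5(b) · EL♮(3)] E-NEG(1), part 1 — an EXACT SHADOW after one section blow-up is PLANAR and is the STRICT
# TRANSFORM of its image (conclusions (i), (ii) of PLANNER-MEMO-g9-1 v1.1 e3f1eec291b7112d; crux `EquisingularLiftNatThree` =
# stmt-ResolutionOfSingularities-20148, parent `EquisingularLiftNat` = stmt-20038)

NOT a statement of any manuscript. Helper file of the chain res-L1-w45b (cell `res-hironaka`, rung L, slot W4.5(b)); AI-written,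
weaker than expert review; filed `--supports stmt-ResolutionOfSingularities-20148 --as helper`; it closes nothing. Object (O1)
E-NEG(1) of res-L1-w45b-plan-1's PLANNER-MEMO-g9-1 («one-level exactness forces an in-carrier equimultiple section», the kernel
cut of res-L1-w45b-idea-2's E-NEGATIVITY R6-2): the NEGATIVE companion of the rungs v7′ / T-PROX, not load-bearing for `closes`.

SETTING (set-level EL♮ currency of T-CR / CARRIER DICHOTOMY). `O` a DVR; `r : P → Spec O` proper, `P` integral and locally
Noetherian; `x` a section of `r` (closed immersion, `x ≫ r = 𝟙`); `τ₁ : X₁ → P` the blow-up along `ker x`, CARRIER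
`E := τ₁⁻¹(supp ker x)`; `s` a section of `X₁ → Spec O` (closed immersion); `τ : X₂ → X₁` the blow-up along `ker s`; `Γ ⊆ X₁`
a set inside the carrier with `Γ ∖ supp ker s` infinite (a CURVE through `q = s(s₀)`, not the point); `C` an ideal sheaf on `X₂` with
`V(C)` integral and `O`-flat whose SPECIAL FIBRE is the strict transform `Γ̃ := closure τ⁻¹(Γ ∖ supp ker s)` of `Γ` AS A SET
(«exact shadow at one level», set-level half).

CONTENT.
* `exists_preimage_of_not_mem_support`, `image_closure_eq_of_isBlowup` — a blow-up is onto off its centre; a blow-up is a closed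
  map, so `τ(closure A) = closure τ(A)`.
* **`image_support_subset_carrier_of_exactShadow`** — (i) PLANARITY: `D♭ := τ(supp C) ⊆ E` (T-CR
  `subset_preimage_support_of_infinite_specialFibre`, res-D-pv-003: `D♭` is closed irreducible horizontal with infinite special fibre
  `⊇ Γ ∖ {q}` inside `E`).
* **`support_eq_strictTransform_image_of_exactShadow`** — (ii) `supp C = closure τ⁻¹(D♭ ∖ supp ker s)` = `St_s(D♭)` (CARRIER
  DICHOTOMY `subset_preimage_support_or_eq_strictTransform`: the alternative `supp C ⊆ τ⁻¹(supp ker s)` is excluded by a point of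
  `Γ̃` off the exceptional divisor).
* `exactShadow_planar_and_strictTransform` — both at once, plus «`D♭` closed, irreducible, horizontal».
Parts (iii) `s ⊆ D♭` (T-FIBRE, Cohen–Macaulay form) and (iv) equimultiplicity (TOOTH FORMULA) are separate files.

References: U. Görtz, T. Wedhorn, *Algebraic Geometry I* (2020), Prop. 13.91 (3); The Stacks Project, Tag 080E; H. Matsumura,
*Commutative Ring Theory* (1986), Thm. 15.5 — through the cited tree files. OURS planning text (index only): L/w45b/PLANNER-MEMO-g9-1.md.
-/

set_option linter.dupNamespace false -- mandated namespace `Summit.<Summit>.<Problem>` of this single-conjunct summit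
set_option linter.overlappingInstances false -- signatures carry `[IsDomain O] [IsDiscreteValuationRing O]`

open CategoryTheory AlgebraicGeometry TopologicalSpace Topology
open AlgebraicGeometry.Scheme.IdealSheafData Literature.AlgebraicGeometry.Resolution
open Summit.ResolutionOfSingularities.ResolutionOfSingularities.Theses.EquisingularLift.Split

namespace Summit.ResolutionOfSingularities.ResolutionOfSingularities.Cruxes.EquisingularLiftNat.Sections

/-! ## Two set-level facts about blow-ups -/

/-- **A blow-up is onto off its centre**: every point of `X ∖ supp I` has a preimage under `τ`
(GW I Prop. 13.91 (3): `τ` is an isomorphism over the complement of the centre). [cite: GortzWedhorn2020, Prop. 13.91 (3)] -/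
theorem exists_preimage_of_not_mem_support {X X' : Scheme.{0}} [IsLocallyNoetherian X] (τ : X' ⟶ X)
    (I : X.IdealSheafData) (hτ : IsBlowup τ I)
    {y : X} (hy : y ∉ (I.support : Set X)) : ∃ x' : X', τ x' = y := by
  obtain ⟨x', hx', -⟩ := existsUnique_preimage τ hτ.isIso_compl (W := centreCompl I) (y := y) hy
  exact ⟨x', hx'⟩

/-- **A blow-up is a closed map**: `τ(closure A) = closure τ(A)`. [folklore] -/
theorem image_closure_eq_of_isBlowup {X X' : Scheme.{0}} [IsLocallyNoetherian X] (τ : X' ⟶ X) (I : X.IdealSheafData)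
    (hτ : IsBlowup τ I) (A : Set X') : τ '' closure A = closure (τ '' A) := by
  haveI : IsProper τ := hτ.isProper
  exact ((τ.isClosedMap).closure_image_eq_of_continuous τ.continuous A).symm

/-! ## E-NEG(1) (i), (ii) -/

section ExactShadow

variable {O : Type} [CommRing O] [IsDomain O] [IsDiscreteValuationRing O] {P X₁ X₂ : Scheme.{0}}
  [IsIntegral P] [IsLocallyNoetherian P]

/-- **E-NEG(1) (i) — PLANARITY of the shadow's image.** In the SETTING of the module docstring, the image
`D♭ := τ(supp C)` of the exact shadow lies in the carrier `E = τ₁⁻¹(supp ker x)`; it is moreover closed, irreducible and horizontal.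
Proof: `D♭` is closed (blow-ups are proper) and irreducible (image of the integral `V(C)`); it is horizontal because `V(C)` is
(`O`-flat, `not_support_subset_preimage_closedPoint_of_flat`); its special fibre is `τ(Γ̃) = closure (Γ ∖ supp ker s)`, inside `E`
and infinite; T-CR (`subset_preimage_support_of_infinite_specialFibre`, res-D-pv-003) concludes.
[cite: StacksProject, Tag 080E; Matsumura1987, Thm. 15.5] [OURS · L1 W4.5b] -/
theorem image_support_subset_carrier_of_exactShadow [IsLocallyNoetherian X₁] (r : P ⟶ Spec (.of O)) [IsProper r]
    (x : Spec (.of O) ⟶ P) [IsClosedImmersion x] (hx : CategoryStruct.comp x r = CategoryStruct.id _)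
    (τ₁ : X₁ ⟶ P) (hτ₁ : IsBlowup τ₁ x.ker) (s : Spec (.of O) ⟶ X₁)
    (τ : X₂ ⟶ X₁) (hτ : IsBlowup τ s.ker)
    (Γ : Set X₁) (hΓE : Γ ⊆ τ₁ ⁻¹' (x.ker.support : Set P)) (hΓinf : (Γ \ (s.ker.support : Set X₁)).Infinite)
    (C : X₂.IdealSheafData) (hCint : IsIntegral C.subscheme)
    (hflat : Flat (CategoryStruct.comp C.subschemeι (CategoryStruct.comp τ (CategoryStruct.comp τ₁ r))))
    (hCsp : (C.support : Set X₂) ∩ (CategoryStruct.comp τ (CategoryStruct.comp τ₁ r)) ⁻¹' {IsLocalRing.closedPoint O} =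
      closure (τ ⁻¹' (Γ \ (s.ker.support : Set X₁)))) :
    IsClosed (τ '' (C.support : Set X₂)) ∧ IsIrreducible (τ '' (C.support : Set X₂)) ∧
      ¬ τ '' (C.support : Set X₂) ⊆ (CategoryStruct.comp τ₁ r) ⁻¹' {IsLocalRing.closedPoint O} ∧
      τ '' (C.support : Set X₂) ⊆ τ₁ ⁻¹' (x.ker.support : Set P) := by
  haveI : IsProper τ₁ := hτ₁.isProper
  haveI : IsProper τ := hτ.isProper
  haveI : CompactSpace P := QuasiCompact.compactSpace_of_compactSpace r
  haveI := hCint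
  obtain ⟨ϖ, hϖ⟩ := IsDiscreteValuationRing.exists_irreducible O
  -- the special fibre of `P` as a zero locus
  have hF : P.zeroLocus ({r.appTop ((Scheme.ΓSpecIso (.of O)).inv ϖ)} : Set Γ(P, ⊤)) =
      r ⁻¹' {IsLocalRing.closedPoint O} :=
    zeroLocus_appTop_eq_preimage_closedPoint hϖ r
  -- `D♭` is closed and irreducible
  have hCcl : IsClosed (C.support : Set X₂) := C.support.isClosed
  have hCirr : IsIrreducible (C.support : Set X₂) := by
    rw [← Scheme.IdealSheafData.range_subschemeι, ← Set.image_univ]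
    exact (IrreducibleSpace.isIrreducible_univ _).image _ C.subschemeι.continuous.continuousOn
  have hDcl : IsClosed (τ '' (C.support : Set X₂)) := τ.isClosedMap _ hCcl
  have hDirr : IsIrreducible (τ '' (C.support : Set X₂)) := hCirr.image _ τ.continuous.continuousOn
  -- `V(C)` is horizontal, hence so is `D♭`
  have hCgen : ¬ (C.support : Set X₂) ⊆
      (CategoryStruct.comp τ (CategoryStruct.comp τ₁ r)) ⁻¹' {IsLocalRing.closedPoint O} :=
    not_support_subset_preimage_closedPoint_of_flat _ C hflat
      (by rw [← Scheme.IdealSheafData.range_subschemeι]; exact Set.range_nonempty _)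
  have hDgen : ¬ τ '' (C.support : Set X₂) ⊆ (CategoryStruct.comp τ₁ r) ⁻¹' {IsLocalRing.closedPoint O} := by
    intro h
    apply hCgen
    intro c hc
    have h1 := h ⟨c, hc, rfl⟩
    simpa only [Set.mem_preimage, Scheme.Hom.comp_apply] using h1
  -- the special fibre of `D♭` is `τ(Γ̃) = closure (Γ ∖ supp ker s)`: inside `E`, and infinite
  have hDsp_eq : τ '' (C.support : Set X₂) ∩ (CategoryStruct.comp τ₁ r) ⁻¹' {IsLocalRing.closedPoint O} =
      τ '' closure (τ ⁻¹' (Γ \ (s.ker.support : Set X₁))) := by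
    rw [← hCsp]
    ext y
    constructor
    · rintro ⟨⟨c, hc, rfl⟩, hy⟩
      refine ⟨c, ⟨hc, ?_⟩, rfl⟩
      simpa only [Set.mem_preimage, Scheme.Hom.comp_apply] using hy
    · rintro ⟨c, ⟨hc, hcsp⟩, rfl⟩
      refine ⟨⟨c, hc, rfl⟩, ?_⟩
      simpa only [Set.mem_preimage, Scheme.Hom.comp_apply] using hcsp
  have hΓcl : τ '' closure (τ ⁻¹' (Γ \ (s.ker.support : Set X₁))) ⊆ τ₁ ⁻¹' (x.ker.support : Set P) := by
    rw [image_closure_eq_of_isBlowup τ s.ker hτ]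
    refine closure_minimal ?_ (x.ker.support.isClosed.preimage τ₁.continuous)
    rintro _ ⟨c, ⟨hc, -⟩, rfl⟩
    exact hΓE hc
  have hsub : Γ \ (s.ker.support : Set X₁) ⊆ τ '' closure (τ ⁻¹' (Γ \ (s.ker.support : Set X₁))) := by
    intro y hy
    obtain ⟨c, hc⟩ := exists_preimage_of_not_mem_support τ s.ker hτ hy.2
    exact ⟨c, subset_closure (by rw [Set.mem_preimage, hc]; exact hy), hc⟩
  have hDinf : (τ '' (C.support : Set X₂) ∩ (CategoryStruct.comp τ₁ r) ⁻¹' {IsLocalRing.closedPoint O}).Infinite := by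
    rw [hDsp_eq]
    exact hΓinf.mono hsub
  -- T-CR
  have hI : (x.ker.support : Set P) ∩ P.zeroLocus ({r.appTop ((Scheme.ΓSpecIso (.of O)).inv ϖ)} : Set Γ(P, ⊤)) ⊆
      {x (IsLocalRing.closedPoint O)} := by
    rintro y ⟨hy, hyF⟩
    rw [hF] at hyF
    have hy' : y ∈ closure (Set.range x) := by
      rw [← Scheme.Hom.support_ker]; exact hy
    rw [x.isClosedEmbedding.isClosed_range.closure_eq] at hy'
    obtain ⟨u, rfl⟩ := hy'
    have hu : u = IsLocalRing.closedPoint O := by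
      have h1 : r (x u) = IsLocalRing.closedPoint O := hyF
      rw [← Scheme.Hom.comp_apply, hx] at h1
      simpa using h1
    rw [hu]
    rfl
  have hF' : τ₁ ⁻¹' P.zeroLocus ({r.appTop ((Scheme.ΓSpecIso (.of O)).inv ϖ)} : Set Γ(P, ⊤)) =
      (CategoryStruct.comp τ₁ r) ⁻¹' {IsLocalRing.closedPoint O} := by
    rw [hF]; ext y; simp only [Set.mem_preimage, Scheme.Hom.comp_apply]
  refine ⟨hDcl, hDirr, hDgen, ?_⟩
  refine subset_preimage_support_of_infinite_specialFibre τ₁ x.ker hτ₁ _ (x (IsLocalRing.closedPoint O)) hI hDcl hDirr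
    (by rw [hF']; exact hDgen) (by rw [hF', hDsp_eq]; exact hΓcl) (by rw [hF']; exact hDinf)

omit [IsIntegral P] [IsLocallyNoetherian P] in
/-- **E-NEG(1) (ii) — the shadow IS the strict transform of its image.** In the SETTING of the module docstring,
`supp C = closure τ⁻¹(D♭ ∖ supp ker s)` with `D♭ = τ(supp C)` (CARRIER DICHOTOMY, res-D-pv-003: the alternative
`supp C ⊆ τ⁻¹(supp ker s)` is impossible, a point of `Γ̃` over `Γ ∖ {q}` lying off the exceptional divisor).
[cite: GortzWedhorn2020, Prop. 13.91 (3)] [OURS · L1 W4.5b] -/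
theorem support_eq_strictTransform_image_of_exactShadow [IsLocallyNoetherian X₁] (r : P ⟶ Spec (.of O))
    (τ₁ : X₁ ⟶ P) (s : Spec (.of O) ⟶ X₁) (τ : X₂ ⟶ X₁) (hτ : IsBlowup τ s.ker)
    (Γ : Set X₁) (hΓinf : (Γ \ (s.ker.support : Set X₁)).Infinite)
    (C : X₂.IdealSheafData) (hCint : IsIntegral C.subscheme)
    (hCsp : (C.support : Set X₂) ∩ (CategoryStruct.comp τ (CategoryStruct.comp τ₁ r)) ⁻¹' {IsLocalRing.closedPoint O} =
      closure (τ ⁻¹' (Γ \ (s.ker.support : Set X₁)))) :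
    ¬ τ '' (C.support : Set X₂) ⊆ (s.ker.support : Set X₁) ∧
      (C.support : Set X₂) = closure (τ ⁻¹' (τ '' (C.support : Set X₂) \ (s.ker.support : Set X₁))) := by
  haveI := hCint
  have hCcl : IsClosed (C.support : Set X₂) := C.support.isClosed
  have hCirr : IsIrreducible (C.support : Set X₂) := by
    rw [← Scheme.IdealSheafData.range_subschemeι, ← Set.image_univ]
    exact (IrreducibleSpace.isIrreducible_univ _).image _ C.subschemeι.continuous.continuousOn
  -- a point of `Γ̃ ⊆ supp C` off the exceptional divisor
  obtain ⟨y, hy⟩ := hΓinf.nonempty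
  obtain ⟨c, hc⟩ := exists_preimage_of_not_mem_support τ s.ker hτ hy.2
  have hcC : c ∈ (C.support : Set X₂) := by
    have h1 : c ∈ closure (τ ⁻¹' (Γ \ (s.ker.support : Set X₁))) :=
      subset_closure (by rw [Set.mem_preimage, hc]; exact hy)
    rw [← hCsp] at h1
    exact h1.1
  rcases subset_preimage_support_or_eq_strictTransform τ s.ker hτ hCcl hCirr with h | ⟨-, -, hDI, hSt⟩
  · exfalso
    have h1 := h hcC
    rw [Set.mem_preimage, hc] at h1
    exact hy.2 h1
  · exact ⟨hDI, hSt⟩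

/-- **E-NEG(1) (i)+(ii) together** (PLANNER-MEMO-g9-1 §1: «an exact shadow is planar and is the strict transform of its image»):
`D♭ = τ(supp C)` is closed, irreducible, horizontal, lies in the carrier `E`, is not inside `supp ker s`, and
`supp C = St_s(D♭) = closure τ⁻¹(D♭ ∖ supp ker s)`. [cite: StacksProject, Tag 080E; GortzWedhorn2020, Prop. 13.91 (3)]
[OURS · L1 W4.5b] -/
theorem exactShadow_planar_and_strictTransform [IsLocallyNoetherian X₁] (r : P ⟶ Spec (.of O)) [IsProper r]
    (x : Spec (.of O) ⟶ P) [IsClosedImmersion x] (hx : CategoryStruct.comp x r = CategoryStruct.id _)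
    (τ₁ : X₁ ⟶ P) (hτ₁ : IsBlowup τ₁ x.ker) (s : Spec (.of O) ⟶ X₁)
    (τ : X₂ ⟶ X₁) (hτ : IsBlowup τ s.ker)
    (Γ : Set X₁) (hΓE : Γ ⊆ τ₁ ⁻¹' (x.ker.support : Set P)) (hΓinf : (Γ \ (s.ker.support : Set X₁)).Infinite)
    (C : X₂.IdealSheafData) (hCint : IsIntegral C.subscheme)
    (hflat : Flat (CategoryStruct.comp C.subschemeι (CategoryStruct.comp τ (CategoryStruct.comp τ₁ r))))
    (hCsp : (C.support : Set X₂) ∩ (CategoryStruct.comp τ (CategoryStruct.comp τ₁ r)) ⁻¹' {IsLocalRing.closedPoint O} =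
      closure (τ ⁻¹' (Γ \ (s.ker.support : Set X₁)))) :
    IsClosed (τ '' (C.support : Set X₂)) ∧ IsIrreducible (τ '' (C.support : Set X₂)) ∧
      ¬ τ '' (C.support : Set X₂) ⊆ (CategoryStruct.comp τ₁ r) ⁻¹' {IsLocalRing.closedPoint O} ∧
      τ '' (C.support : Set X₂) ⊆ τ₁ ⁻¹' (x.ker.support : Set P) ∧
      ¬ τ '' (C.support : Set X₂) ⊆ (s.ker.support : Set X₁) ∧
      (C.support : Set X₂) = closure (τ ⁻¹' (τ '' (C.support : Set X₂) \ (s.ker.support : Set X₁))) := by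
  obtain ⟨h1, h2, h3, h4⟩ := image_support_subset_carrier_of_exactShadow r x hx τ₁ hτ₁ s τ hτ Γ hΓE hΓinf C hCint hflat hCsp
  obtain ⟨h5, h6⟩ := support_eq_strictTransform_image_of_exactShadow r τ₁ s τ hτ Γ hΓinf C hCint hCsp
  exact ⟨h1, h2, h3, h4, h5, h6⟩

end ExactShadow

end Summit.ResolutionOfSingularities.ResolutionOfSingularities.Cruxes.EquisingularLiftNat.Sections
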